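import Summits.HodgeConjecture.CorCM.MultiFieldWeilTwinSextics
import Summits.HodgeConjecture.CorCM.MultiFieldWeilNonIsomorphicGroupBlocks
import HarnessLib

/-!
# MULTI-FIELD WEIL ENGINE — THE TWIN GROUP BLOCK: in a uniform family, a group of sextic slots through one imaginary quadratic field `k` containing ONE pair of slots with
# ISOMORPHIC fields (two types of one field) and otherwise pairwise non-isomorphic fields, with any CM elliptic curves through `k` — the Hodge conjecture for every product of
# copies, given ONLY Markman's fourfold theorem

Cell `pub-hodgecm2` (COR-CM), seat b30 gen 37 (2026-08-25); count-neutral own lane MULTI-FIELD WEIL ENGINE (stem `MultiFieldWeil*`), the family dress of T3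
`CorCM/MultiFieldWeilTwinSextics.lean` §2 in the pattern of V4 §1 `hodgeConjectureFor_prod_groupBlock_of_outside_closures` and X4a `CorCM/MultiFieldWeilIsolatedPairBlock.lean`.
Theorems only; no definition, no named fact, no `sorry`.  HONEST FRAMING: conditional ONLY on `Markman2025_weilClasses_algebraic_abelianFourfold`; `HC_CM` is NOT proved and not asserted.

**`hodgeConjectureFor_prod_twinGroupBlock_of_isEmpty_ringHom`** — `A_i ⊨ (K_i; Φ_i)` simple; sextic slots `t ≠ t'` with `K_{t'} ≃ K_t ∋ i(k)` carrying NON-ISOGENOUS varieties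
(two types of one field), and `e : Fin r → I` further sextic slots with `K_{e m} ∋ i_m(k)`, `Hom(K_{e m}, K_t) = ∅`, `Hom(K_{e m}, K_{e m₀}) = ∅` (`m₀ ≠ m`); a product of copies
every member of which is `A_t`, `A_{t'}`, some `A_{e m}`, or a CM elliptic curve whose field embeds in `K_t` or in some `K_{e m}`.  Then the Hodge conjecture holds for it: every such
curve is isogenous to the CM curve `E ⊨ (k; {τ})`, `A_{t'}` is re-read over `K_t` (`IsCMTypeRealisation.transport`), and the product is isogenous to a product of copies of the
concrete family `(E, A_t, A_{t'}, A_{e 0}, …)` over the fields `Option.elim · k K` settled by T3 §2.  PURPOSE: the block of a k-group with ONE isomorphic pair in the classes-per-field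
theorems — «isolated» in `CorCM/MultiFieldWeilTwoPerIsolatedField*` may now keep other threefolds over `k` with different closures (the port is the sequel).
[cite: Markman2025SurveySecant, Thm. 1.2] [cite: Shimura1998, §6.1 Corollary of Theorem 2 (p. 41), §8.2 Prop. 26, §18.2 Lemma (i)] [cite: Lang2002, VI §1 Thm. 1.1 and Cor. 1.6]
[cite: MumfordAV1970, §19 Thm. 1 and p. 169]

## References
* [Markman2025SurveySecant] E. Markman, arXiv:2509.23403, Thm. 1.2.  [Shimura1998] G. Shimura, CM book, §6.1, §8.2, §18.2.  [Lang2002] S. Lang, *Algebra*, VI §1.  [MumfordAV1970]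
  D. Mumford, *Abelian Varieties*, §19.
-/

noncomputable section

open CategoryTheory CategoryTheory.Limits NumberField IntermediateField

namespace Summit.HodgeConjecture.CorCM.MultiFieldWeil

open Finset
open Literature.AlgebraicGeometry Literature.AlgebraicGeometry.Motives Literature.AlgebraicGeometry.HodgeTheory
open Literature.AlgebraicGeometry.ComplexMultiplication (IsCMTypeRealisation)
open Literature.AlgebraicTopology.SingularHomology
open Literature.NumberTheory.ComplexMultiplication
open Literature.AlgebraicGeometry.Pohlmann1968

open scoped Classical

section TwinGroup

variable {I : Type} {K : I → Type} [fK : ∀ i, Field (K i)] [nK : ∀ i, NumberField (K i)] [cK : ∀ i, IsCMField (K i)]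
  {Φ : ∀ i, CMType (K i)} {A : I → AbelianVariety ℂ} {ι : ∀ i, 𝓞 (K i) →+* End (A i)} {θ : ∀ i, K i →+* Module.End ℂ (complexBetti (A i).X 1)}

/-- **THE TWIN GROUP BLOCK.**  See the module docstring.  `HC_CM` is NOT asserted. [cite: Markman2025SurveySecant, Thm. 1.2] [cite: Shimura1998, §6.1 Corollary of Theorem 2, §18.2 Lemma (i)]
[cite: MumfordAV1970, §19 Thm. 1 and p. 169] -/
theorem hodgeConjectureFor_prod_twinGroupBlock_of_isEmpty_ringHom (hW4 : Markman2025_weilClasses_algebraic_abelianFourfold)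
    (hA : ∀ i, IsCMTypeRealisation (Φ i) (A i) (ι i) (θ i)) (hS : ∀ i, (A i).IsSimple) (t t' : I) (h6t : Module.finrank ℚ (K t) = 6) (εt : K t' ≃+* K t)
    (hni : ¬ AbelianVariety.IsIsogenous (A t) (A t')) {r : ℕ} (e : Fin r → I) (h6 : ∀ m, Module.finrank ℚ (K (e m)) = 6)
    {k : Type} [fk : Field k] [nk : NumberField k] [ck : IsCMField k] (h2 : Module.finrank ℚ k = 2) (i : k →+* K t) (im : ∀ m, k →+* K (e m))
    (hisoT : ∀ m, IsEmpty (K (e m) →+* K t)) (hiso : ∀ m₀ m : Fin r, m₀ ≠ m → IsEmpty (K (e m) →+* K (e m₀)))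
    {M : ℕ} (ρ : Fin M → I)
    (hρ : ∀ l, (Module.finrank ℚ (K (ρ l)) = 2 ∧ (Nonempty (K (ρ l) →+* K t) ∨ ∃ m, Nonempty (K (ρ l) →+* K (e m)))) ∨ ρ l = t ∨ ρ l = t' ∨ ∃ m, ρ l = e m) :
    HodgeConjectureFor (⨁ fun l => A (ρ l)).dim (⨁ fun l => A (ρ l)).X := by
  -- the CM elliptic curve of `k`
  obtain ⟨τ⟩ : Nonempty (k →+* ℂ) := inferInstance
  obtain ⟨Ψ, E, ιE, θE, hE, hΨ⟩ := exists_cmCurve_iff_eq h2 τ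
  -- every curve member is isogenous to `E`
  have hcurve : ∀ l, (Module.finrank ℚ (K (ρ l)) = 2 ∧ (Nonempty (K (ρ l) →+* K t) ∨ ∃ m, Nonempty (K (ρ l) →+* K (e m)))) → AbelianVariety.IsIsogenous (A (ρ l)) E := by
    rintro l ⟨h2l, hg | ⟨m, hg⟩⟩ <;> obtain ⟨g⟩ := hg
    · obtain ⟨φ⟩ := WeilFibre.nonempty_algEquiv_of_finrank_eq_two (M := K t) h2l h2 (by rw [h6t]; decide) g.toRatAlgHom i.toRatAlgHom
      exact isIsogenous_of_ringEquiv h2l (hA (ρ l)) hE φ.symm.toRingEquiv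
    · obtain ⟨φ⟩ := WeilFibre.nonempty_algEquiv_of_finrank_eq_two (M := K (e m)) h2l h2 (by rw [h6 m]; decide) g.toRatAlgHom (im m).toRatAlgHom
      exact isIsogenous_of_ringEquiv h2l (hA (ρ l)) hE φ.symm.toRingEquiv
  -- the concrete family over the fields `Option.elim · k K`: slots `t, t, e 0, …, e (r-1)` after the curve
  let Kf : Option I → Type := fun o => o.elim k K
  letI instF : ∀ o, Field (Kf o) := fun o => @Option.rec I (fun o => Field (Option.elim o k K)) fk (fun j => fK j) o
  letI instN : ∀ o, NumberField (Kf o) := fun o => @Option.rec I (fun o => NumberField (Option.elim o k K)) nk (fun j => nK j) o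
  haveI instC : ∀ o, IsCMField (Kf o) := fun o => @Option.rec I (fun o => IsCMField (Option.elim o k K)) ck (fun j => cK j) o
  let T : Fin (r + 2) → AbelianVariety ℂ := Fin.cons (A t) (Fin.cons (A t') fun m => A (e m))
  obtain ⟨Φ', ι', θ', hA', h0, -⟩ := exists_realisations_cons (Kf := Kf) (i₀ := none) (is := (Fin.cons (some t) (Fin.cons (some t) fun m => some (e m)) : Fin (r + 2) → Option I))
    (T := T) (ΦT := Fin.cons (Φ t) (Fin.cons (Literature.NumberTheory.Automorphic.PicardCM.CMCode.cmTypeMap εt (Φ t')) fun m => Φ (e m)))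
    (ιT := Fin.cons (ι t) (Fin.cons ((ι t').comp (RingOfIntegers.mapRingEquiv εt.symm).toRingHom) fun m => ι (e m)))
    (θT := Fin.cons (θ t) (Fin.cons ((θ t').comp εt.symm.toRingHom) fun m => θ (e m)))
    (Ψ := Ψ) (E := E) (ιE := ιE) (θE := θE) hE
    (fun m => Fin.cases (hA t) (fun m => Fin.cases ((hA t').transport εt) (fun m => hA (e m)) m) m)
  have hΨ' : ∀ σ : Kf none →+* ℂ, σ ∈ (Φ' 0).1 ↔ σ = τ := by rw [h0]; exact hΨ
  -- the slot map
  let V : Fin (r + 2 + 1) → AbelianVariety ℂ := Fin.cons E T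
  let σ : I → Fin (r + 2 + 1) := fun x =>
    if h : ∃ m, x = e m then (Classical.choose h).succ.succ.succ else if x = t then Fin.succ 0 else if x = t' then (Fin.succ 0).succ else 0
  have het : ∀ m, e m ≠ t := fun m h => (hisoT m).false (by rw [h]; exact RingHom.id _)
  have het' : ∀ m, e m ≠ t' := fun m h => (hisoT m).false (by rw [h]; exact εt.toRingHom)
  have hσ : ∀ l, AbelianVariety.IsIsogenous (A (ρ l)) (V (σ (ρ l))) := by
    intro l
    by_cases h : ∃ m, ρ l = e m
    · have hs : σ (ρ l) = (Classical.choose h).succ.succ.succ := by simp only [σ, dif_pos h]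
      rw [hs]
      show AbelianVariety.IsIsogenous (A (ρ l)) (A (e (Classical.choose h)))
      rw [← Classical.choose_spec h]
      exact AbelianVariety.IsIsogenous.refl _
    by_cases ht : ρ l = t
    · have hs : σ (ρ l) = Fin.succ 0 := by simp only [σ, dif_neg h, if_pos ht]
      rw [hs, ht]
      exact AbelianVariety.IsIsogenous.refl _
    by_cases ht' : ρ l = t'
    · have hs : σ (ρ l) = (Fin.succ 0).succ := by simp only [σ, dif_neg h, if_neg ht, if_pos ht']
      rw [hs, ht']
      exact AbelianVariety.IsIsogenous.refl _
    have hs : σ (ρ l) = 0 := by simp only [σ, dif_neg h, if_neg ht, if_neg ht']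
    rw [hs]
    exact hcurve l ((hρ l).resolve_right fun h' => h'.elim ht fun h'' => h''.elim ht' h)
  have hisoV : AbelianVariety.IsIsogenous (⨁ fun l => A (ρ l)) (⨁ fun l => V (σ (ρ l))) := AbelianVariety.IsIsogenous.biproduct hσ
  refine Domination.hodgeConjectureFor_of_avDominatedBy ?_ (Domination.AVDominatedBy.of_isIsogenous hisoV (Domination.AVDominatedBy.refl _))
  exact hodgeConjectureFor_biproduct_comp_of_simpleSexticTwins_of_isEmpty_ringHom (Kf := Kf) (i₀ := none) (i₁ := some t) (is' := fun m => some (e m)) hW4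
    (fun l => σ (ρ l)) h2 h6t h6 i im hA' hΨ' (hS t) (hS t') hni (fun m => hS (e m)) hisoT hiso

/-- **Dominated form of the twin group block.** [cite: Markman2025SurveySecant, Thm. 1.2] [cite: MumfordAV1970, §19 Thm. 1 and p. 169] -/
theorem hodgeConjectureFor_of_avDominatedBy_prod_twinGroupBlock_of_isEmpty_ringHom (hW4 : Markman2025_weilClasses_algebraic_abelianFourfold)
    (hA : ∀ i, IsCMTypeRealisation (Φ i) (A i) (ι i) (θ i)) (hS : ∀ i, (A i).IsSimple) (t t' : I) (h6t : Module.finrank ℚ (K t) = 6) (εt : K t' ≃+* K t)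
    (hni : ¬ AbelianVariety.IsIsogenous (A t) (A t')) {r : ℕ} (e : Fin r → I) (h6 : ∀ m, Module.finrank ℚ (K (e m)) = 6)
    {k : Type} [Field k] [NumberField k] [IsCMField k] (h2 : Module.finrank ℚ k = 2) (i : k →+* K t) (im : ∀ m, k →+* K (e m))
    (hisoT : ∀ m, IsEmpty (K (e m) →+* K t)) (hiso : ∀ m₀ m : Fin r, m₀ ≠ m → IsEmpty (K (e m) →+* K (e m₀)))
    {M : ℕ} (ρ : Fin M → I)
    (hρ : ∀ l, (Module.finrank ℚ (K (ρ l)) = 2 ∧ (Nonempty (K (ρ l) →+* K t) ∨ ∃ m, Nonempty (K (ρ l) →+* K (e m)))) ∨ ρ l = t ∨ ρ l = t' ∨ ∃ m, ρ l = e m)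
    {X : AbelianVariety ℂ} (hX : Domination.AVDominatedBy X (⨁ fun l => A (ρ l))) : HodgeConjectureFor X.dim X.X :=
  Domination.hodgeConjectureFor_of_avDominatedBy (hodgeConjectureFor_prod_twinGroupBlock_of_isEmpty_ringHom hW4 hA hS t t' h6t εt hni e h6 h2 i im hisoT hiso ρ hρ) hX

end TwinGroup

end Summit.HodgeConjecture.CorCM.MultiFieldWeil

end
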